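/-
Copyright (c) 2026 the pub-hodgecm-mathlib formalisation cell (harness21).  Prover seat hodgecm-mathlib-LH4-p12 (g4), Track A «(D-RAM) FOUR-FRAME», unit U2H, the census leaf
(ρ2b′-X) `stub_U2H_fixedPointCensus_typeTwo_unit0` — PAYER-PLAN-rho2bX v2 brick T4 «order lattices» (dictionary D3–D4), part I: the ORDERS.  2026-09-04.
-/
import Literature.NumberTheory.LocalFields.WildQuadraticEisensteinFrame   -- ★ `exists_fixed_coords_of_map_ne` (coordinates `z = a + b·α`), (Π5) integrality of the Eisenstein frame
import HarnessLib

/-!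
# The orders `𝒪_E + c·𝒪_M` of a quadratic extension with an integral power basis, with NO hypothesis on `2`: coordinates, the orders as a `ρ`-stable chain of subrings,
# the multiplier criterion, and the trace dual `(𝒪_E + c𝒪_M)^* = (c(α − ρα))⁻¹·(𝒪_E + c𝒪_M)` (Euler)
(Serre, *Local Fields* Ch. III §6 Prop. 11 + Lemma 2 (Euler), Prop. 12; Flicker 1998 p. 84 REMARK (J. G. M. Mars: «the orders of `E` are `R + π^j R_E`»))

Topic `NumberTheory/LocalFields`; namespace `Literature.NumberTheory.LocalFields.QuadraticOrder`.  THEOREMS ONLY (no definition, no instance, no notation, no named fact,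
no `sorry`); kernel lane `--supports stmt-HodgeConjecture-24833` (count-neutral).  Cell `pub/hodgecm-mathlib` (D-0151), crux H413, Track A «(D-RAM) FOUR-FRAME», unit U2H:
in the toric ∕ order reduction of the WILD type-(2) fixed-point census (ρ2b′-X) (LH4-p12 (g3) PAYER-PLAN-rho2bX v2 §1 D3–D4, §2 T4) the plane `W` is a line over the
biquadratic field `M = E(λ)`, a `λ`-stable `𝒪_E`-lattice of `W` is `x·𝒪_j` with `𝒪_j = 𝒪_E + ϖ_E^j 𝒪_M` an ORDER of `M`, `λ`-stability reads `λ ∈ 𝒪_j` (`j ≤ j_λ`),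
and duals are `𝒪_j^* = (ϖ_E^j(α − ρα))⁻¹𝒪_j`.  The ★ twins `UnramifiedQuadraticOrderLattices` (coordinate `(σx − x)(σa − a)⁻¹` with `σa − a` a UNIT) and
`RamifiedQuadraticOrderLattices` §1 (`x = (x + σx)∕2 + (x − σx)∕2`, `2` a UNIT) do not cover the WILD ramified `M∕E` (`|2| < 1`, no anti-fixed uniformiser — ★
`WildQuadraticEisensteinFrame`); THIS FILE (and its sequel `QuadraticOrderLattices`, Mars' lattice lemma) is the 2-free version keyed on an INTEGRAL POWER BASIS
`𝒪_M = 𝒪_E ⊕ 𝒪_E·α`.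

CURRENCY (one field, as ★ `WildQuadraticEisensteinFrame` §1–§2): `K` (model: `M`) with `Valued K ℤᵐ⁰`, an isometric involution `ρ : K →+* K` (model: `Gal(M∕E)`;
hypotheses `hρρ : ρρ = id`, `hvρ : |ρ x| = |x|` only where used), FIXED elements = the base `E`; `α` with `ρ α ≠ α` and the two COORDINATES of `z`:
`b(z) := (z − ρ z)∕(α − ρ α)` and `a(z) := z − b(z)·α`, both fixed, `z = a(z) + b(z)·α` (★ `exists_fixed_coords_of_map_ne`).  The INTEGRAL-BASIS HYPOTHESIS is
**`hint : ∀ z, |z| ≤ 1 → |b(z)| ≤ 1`** (with `|α| ≤ 1`: `𝒪 = 𝒪^ρ ⊕ 𝒪^ρ·α`, [Serre1979 Ch. III §6 Prop. 12]) — discharged by ★ (Π5) `v_fixed_add_fixed_mul_le_one_iff` when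
`α` is a uniformiser and fixed elements have even order (ramified `M∕E`, tame or wild), and by the unit `σa − a` in the unramified case.  The ORDER OF CONDUCTOR `c`
(`c` fixed, `0 < |c| ≤ 1`; model `c = ϖ_E^j`, the order `𝒪_j`) is the predicate, always spelled out,
  **`|z| ≤ 1 ∧ |z − ρ z| ≤ |c·(α − ρ α)|`**  (⟺ `z = a + c·y` with `a` a fixed integer and `y` an integer, §2).

* §1 COORDINATES (field algebra): `b`, `a` are fixed; `z − ρz = b(z)(α − ρα)`; coordinates of `a + bα` and uniqueness; `b(c z) = c·b(z)` for fixed `c`;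
  **`z∕(α − ρα) + ρ(z∕(α − ρα)) = b(z)`** (the trace of `z∕δ` is the `b`-coordinate — Euler's lemma for `n = 2`); `b(α(a + bα)) = a + b(α + ρα)`;
  `Tr(x·u∕(c(α − ρα))) = b(xu)∕c`.
* §2 THE ORDERS: fixed integers and `c·𝒪` lie in the order; it is a `ρ`-stable subring; **`mem_order_iff_exists`** (`⟺ z = a + c·y`); monotone in `|c|`; `|c| = 1` gives
  all of `𝒪`; membership `⟺ |z| ≤ 1 ∧ |b(z)| ≤ |c|`; `α` lies in the order iff `|c| = 1`.
* §3 MULTIPLIERS: `λ·(order) ⊆ order ⟺ λ ∈ order` (`⟺ |λ| ≤ 1 ∧ |b(λ)| ≤ |c|`: the orders containing a non-fixed integer `λ` are those with `|c| ≥ |b(λ)|`, `j ≤ j_λ`).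
* §4 TRACE DUALS (Euler, `Tr z = z + ρz`): **`forall_v_trace_mul_le_one_iff`**: `Tr(x·y) ∈ 𝒪` for every `x` in the order of conductor `c` `⟺ c(α − ρα)·y` lies in that
  order — i.e. `(𝒪_E + c𝒪_M)^* = (c(α − ρα))⁻¹(𝒪_E + c𝒪_M)` [Serre1979 Ch. III §6 Prop. 11 (ii) for the power basis `1, cα`, `f′(cα) = c(α − ρα)`].
HONEST LABEL: HC_CM is proved only modulo the 7 printed citations (2 remaining named inputs: hLiu418 = stmt-HodgeConjecture-24832, h413 = stmt-HodgeConjecture-24833) until rung 0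
closes; unconditional local algebra, count-neutral (no organ paid, no road opened: brick T4 of the (ρ2b′-X) payer plan; T2 glue decomposition, T3 plane-as-line and the
T5 census are separate files).

## References
* [Serre1979] J.-P. Serre, *Local Fields*, GTM 67 (1979): Ch. III §6 Prop. 11 and Lemma 2 (Euler) (the codifferent of a ring with a power basis `1, x, …, x^{n−1}` is free on
  `x^i∕f′(x)`), Cor. 1–2 (conductor and different), Prop. 12 (integral power bases); Ch. III §3 (codifferent).
* [Flicker1998UnitaryFL] Y. Z. Flicker, *Elementary proof of the fundamental lemma for a unitary group*, Canad. J. Math. 50 (1998), p. 84 REMARK (J. G. M. Mars: the orders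
  of `E` are `R + π^j R_E`; a lattice with multiplier ring `R_E(j)` is `z R_E(j)`).
-/

set_option autoImplicit false

open WithZero

namespace Literature.NumberTheory.LocalFields.QuadraticOrder

/-! ## §1 Coordinates `z = a(z) + b(z)·α` with respect to a non-fixed `α` (field algebra, no valuation) -/

section Algebra

variable {K : Type*} [Field K] {ρ : K →+* K}

/-- The `b`-coordinate `b(z) = (z − ρz)∕(α − ρα)` is `ρ`-fixed (ratio of two anti-fixed elements). [cite: Serre1979, Ch. III §6 Prop. 12] -/
theorem map_bCoord (hρρ : ∀ x, ρ (ρ x) = x) (α z : K) : ρ ((z - ρ z) / (α - ρ α)) = (z - ρ z) / (α - ρ α) := by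
  rw [map_div₀, map_sub, map_sub, hρρ, hρρ, ← neg_sub z, ← neg_sub α, neg_div_neg_eq]

/-- `z − ρz = b(z)·(α − ρα)`. [cite: Serre1979, Ch. III §6 Prop. 12] -/
theorem sub_map_eq_bCoord_mul {α : K} (hα : ρ α ≠ α) (z : K) : z - ρ z = (z - ρ z) / (α - ρ α) * (α - ρ α) := by
  rw [div_mul_cancel₀ _ (sub_ne_zero.2 (Ne.symm hα))]

/-- The `a`-coordinate `a(z) = z − b(z)·α` is `ρ`-fixed. [cite: Serre1979, Ch. III §6 Prop. 12] -/
theorem map_aCoord (hρρ : ∀ x, ρ (ρ x) = x) {α : K} (hα : ρ α ≠ α) (z : K) :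
    ρ (z - (z - ρ z) / (α - ρ α) * α) = z - (z - ρ z) / (α - ρ α) * α := by
  have key := sub_map_eq_bCoord_mul hα z
  rw [map_sub, map_mul, map_bCoord hρρ]
  linear_combination (-1 : K) * key

/-- `z = a(z) + b(z)·α` (tautological reassembly). [cite: Serre1979, Ch. III §6 Prop. 12] -/
theorem aCoord_add_bCoord_mul (α z : K) : (z - (z - ρ z) / (α - ρ α) * α) + (z - ρ z) / (α - ρ α) * α = z := sub_add_cancel z _

/-- The `b`-coordinate of `a + b·α` (`a`, `b` fixed) is `b`. [cite: Serre1979, Ch. III §6 Prop. 12] -/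
theorem bCoord_fixed_add_fixed_mul {α : K} (hα : ρ α ≠ α) {a b : K} (ha : ρ a = a) (hb : ρ b = b) :
    ((a + b * α) - ρ (a + b * α)) / (α - ρ α) = b := by
  have hd : α - ρ α ≠ 0 := sub_ne_zero.2 (Ne.symm hα)
  rw [div_eq_iff hd, map_add, map_mul, ha, hb]; ring

/-- The `a`-coordinate of `a + b·α` (`a`, `b` fixed) is `a`. [cite: Serre1979, Ch. III §6 Prop. 12] -/
theorem aCoord_fixed_add_fixed_mul {α : K} (hα : ρ α ≠ α) {a b : K} (ha : ρ a = a) (hb : ρ b = b) :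
    (a + b * α) - ((a + b * α) - ρ (a + b * α)) / (α - ρ α) * α = a := by
  rw [bCoord_fixed_add_fixed_mul hα ha hb, add_sub_cancel_right]

/-- UNIQUENESS of fixed coordinates: `a + bα = a′ + b′α` with `a, b, a′, b′` fixed forces `a = a′` and `b = b′` (`α` is not fixed). [cite: Serre1979, Ch. III §6 Prop. 12] -/
theorem fixed_coords_unique {α : K} (hα : ρ α ≠ α) {a b a' b' : K} (ha : ρ a = a) (hb : ρ b = b) (ha' : ρ a' = a') (hb' : ρ b' = b')
    (h : a + b * α = a' + b' * α) : a = a' ∧ b = b' := by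
  have hbb : b = b' := by
    have h1 := bCoord_fixed_add_fixed_mul hα ha hb
    rw [h, bCoord_fixed_add_fixed_mul hα ha' hb'] at h1
    exact h1.symm
  refine ⟨?_, hbb⟩
  rw [hbb] at h
  exact add_right_cancel h

/-- `b(c·z) = c·b(z)` for a FIXED scalar `c`. [cite: Serre1979, Ch. III §6 Prop. 12] -/
theorem bCoord_fixed_mul (α : K) {c : K} (hc : ρ c = c) (z : K) : (c * z - ρ (c * z)) / (α - ρ α) = c * ((z - ρ z) / (α - ρ α)) := by
  rw [map_mul, hc, ← mul_sub, mul_div_assoc]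

/-- `b(x + y) = b(x) + b(y)`. [cite: Serre1979, Ch. III §6 Prop. 12] -/
theorem bCoord_add (α x y : K) : ((x + y) - ρ (x + y)) / (α - ρ α) = (x - ρ x) / (α - ρ α) + (y - ρ y) / (α - ρ α) := by
  rw [map_add, ← add_div]; ring_nf

/-- **EULER FOR `n = 2`: the trace of `z∕(α − ρα)` is the `b`-coordinate of `z`** — `z∕(α − ρα) + ρ(z∕(α − ρα)) = (z − ρz)∕(α − ρα)` (so `Tr(1∕f′(α)) = 0` and
`Tr(α∕f′(α)) = 1`, `f′(α) = α − ρα`). [cite: Serre1979, Ch. III §6 Lemma 2] -/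
theorem div_add_map_div (hρρ : ∀ x, ρ (ρ x) = x) {α : K} (hα : ρ α ≠ α) (z : K) :
    z / (α - ρ α) + ρ (z / (α - ρ α)) = (z - ρ z) / (α - ρ α) := by
  have hd : α - ρ α ≠ 0 := sub_ne_zero.2 (Ne.symm hα)
  have hd' : ρ α - α = -(α - ρ α) := by ring
  rw [map_div₀, map_sub, hρρ, hd', div_neg, ← sub_eq_add_neg, ← sub_div]

/-- The `b`-coordinate of `α·(a + bα)` is `a + b·(α + ρα)` (`α² = (α + ρα)α − αρα`). [cite: Serre1979, Ch. III §6 Prop. 11] -/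
theorem bCoord_alpha_mul {α : K} (hα : ρ α ≠ α) {a b : K} (ha : ρ a = a) (hb : ρ b = b) :
    (α * (a + b * α) - ρ (α * (a + b * α))) / (α - ρ α) = a + b * (α + ρ α) := by
  have hd : α - ρ α ≠ 0 := sub_ne_zero.2 (Ne.symm hα)
  rw [div_eq_iff hd, map_mul, map_add, map_mul, ha, hb]; ring

/-- `Tr(x·u∕(c(α − ρα))) = b(xu)∕c` for fixed `c ≠ 0` (Euler for the power basis `1, cα`). [cite: Serre1979, Ch. III §6 Lemma 2] -/
theorem trace_mul_div_eq (hρρ : ∀ x, ρ (ρ x) = x) {α : K} (hα : ρ α ≠ α) {c : K} (hc : ρ c = c) (hc0 : c ≠ 0) (x u : K) :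
    x * (u / (c * (α - ρ α))) + ρ (x * (u / (c * (α - ρ α)))) = (x * u - ρ (x * u)) / (α - ρ α) / c := by
  have hd : α - ρ α ≠ 0 := sub_ne_zero.2 (Ne.symm hα)
  have hrew : x * (u / (c * (α - ρ α))) = (c⁻¹ * (x * u)) / (α - ρ α) := by
    field_simp
  have hcinv : ρ c⁻¹ = c⁻¹ := by rw [map_inv₀, hc]
  rw [hrew, div_add_map_div hρρ hα, bCoord_fixed_mul α hcinv, div_eq_mul_inv _ c, mul_comm]

end Algebra

/-! ## §2 The orders `{z : |z| ≤ 1 ∧ |z − ρz| ≤ |c(α − ρα)|}` = `𝒪^ρ + c·𝒪` of an integral power basis -/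

section Orders

variable {K : Type*} [Field K] [Valued K ℤᵐ⁰] {ρ : K →+* K} {α : K}

/-- `|b(z)|·|α − ρα| = |z − ρz|`. [cite: Serre1979, Ch. III §6 Prop. 12] -/
theorem v_sub_map_eq (hα : ρ α ≠ α) (z : K) : Valued.v (z - ρ z) = Valued.v ((z - ρ z) / (α - ρ α)) * Valued.v (α - ρ α) := by
  rw [← map_mul, ← sub_map_eq_bCoord_mul hα]

/-- `|z − ρz| ≤ |c(α − ρα)| ⟺ |b(z)| ≤ |c|`. [cite: Serre1979, Ch. III §6 Prop. 12] -/
theorem v_sub_map_le_iff (hα : ρ α ≠ α) (c z : K) :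
    Valued.v (z - ρ z) ≤ Valued.v (c * (α - ρ α)) ↔ Valued.v ((z - ρ z) / (α - ρ α)) ≤ Valued.v c := by
  have hd : Valued.v (α - ρ α) ≠ 0 := (Valuation.ne_zero_iff _).2 (sub_ne_zero.2 (Ne.symm hα))
  have hdpos : 0 < Valued.v (α - ρ α) := zero_lt_iff.2 hd
  rw [v_sub_map_eq hα z, map_mul]
  constructor
  · intro h
    have h' : Valued.v (α - ρ α) * Valued.v ((z - ρ z) / (α - ρ α)) ≤ Valued.v (α - ρ α) * Valued.v c := by
      rwa [mul_comm (Valued.v (α - ρ α)), mul_comm (Valued.v (α - ρ α))]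
    exact le_of_mul_le_mul_left h' hdpos
  · intro h
    exact mul_le_mul' h le_rfl

/-- INTEGRALITY OF THE `a`-COORDINATE: under `hint` and `|α| ≤ 1`, an integer `z` has `|a(z)| ≤ 1`. [cite: Serre1979, Ch. III §6 Prop. 12] -/
theorem v_aCoord_le_one (hα1 : Valued.v α ≤ 1) (hint : ∀ z : K, Valued.v z ≤ 1 → Valued.v ((z - ρ z) / (α - ρ α)) ≤ 1)
    {z : K} (hz : Valued.v z ≤ 1) : Valued.v (z - (z - ρ z) / (α - ρ α) * α) ≤ 1 := by
  refine (Valuation.map_sub _ _ _).trans (max_le hz ?_)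
  rw [map_mul]
  exact mul_le_one' (hint z hz) hα1

/-- Every integer lies in the order of conductor `1`: `|z| ≤ 1 ⇒ |z − ρz| ≤ |α − ρα|` (the anti-fixed part of `α` has the LARGEST value). [cite: Serre1979, Ch. III §6 Prop. 12] -/
theorem v_sub_map_le_of_v_le_one (hα : ρ α ≠ α) (hint : ∀ z : K, Valued.v z ≤ 1 → Valued.v ((z - ρ z) / (α - ρ α)) ≤ 1)
    {z : K} (hz : Valued.v z ≤ 1) : Valued.v (z - ρ z) ≤ Valued.v (α - ρ α) := by
  have h := (v_sub_map_le_iff hα 1 z).2 (by rw [map_one]; exact hint z hz)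
  rwa [one_mul] at h

/-- FIXED INTEGERS lie in every order. [cite: Flicker1998UnitaryFL, p. 84 REMARK] -/
theorem mem_order_of_fixed (c : K) {a : K} (ha : ρ a = a) (ha1 : Valued.v a ≤ 1) :
    Valued.v a ≤ 1 ∧ Valued.v (a - ρ a) ≤ Valued.v (c * (α - ρ α)) :=
  ⟨ha1, by rw [ha, sub_self, map_zero]; exact zero_le⟩

/-- `1` lies in every order. [cite: Flicker1998UnitaryFL, p. 84 REMARK] -/
theorem one_mem_order (c : K) : Valued.v (1 : K) ≤ 1 ∧ Valued.v ((1 : K) - ρ 1) ≤ Valued.v (c * (α - ρ α)) :=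
  mem_order_of_fixed c (map_one ρ) (by rw [map_one])

/-- `0` lies in every order. [cite: Flicker1998UnitaryFL, p. 84 REMARK] -/
theorem zero_mem_order (c : K) : Valued.v (0 : K) ≤ 1 ∧ Valued.v ((0 : K) - ρ 0) ≤ Valued.v (c * (α - ρ α)) :=
  mem_order_of_fixed c (map_zero ρ) (by rw [map_zero]; exact zero_le)

/-- `c·y` lies in the order of conductor `c` for every integer `y` (`c` fixed, `|c| ≤ 1`). [cite: Flicker1998UnitaryFL, p. 84 REMARK] -/
theorem conductor_mul_mem_order (hα : ρ α ≠ α) (hint : ∀ z : K, Valued.v z ≤ 1 → Valued.v ((z - ρ z) / (α - ρ α)) ≤ 1)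
    {c : K} (hc : ρ c = c) (hc1 : Valued.v c ≤ 1) {y : K} (hy : Valued.v y ≤ 1) :
    Valued.v (c * y) ≤ 1 ∧ Valued.v (c * y - ρ (c * y)) ≤ Valued.v (c * (α - ρ α)) := by
  refine ⟨by rw [map_mul]; exact mul_le_one' hc1 hy, ?_⟩
  rw [map_mul ρ, hc, ← mul_sub, map_mul, map_mul]
  exact mul_le_mul' le_rfl (v_sub_map_le_of_v_le_one hα hint hy)

/-- `c·α` lies in the order of conductor `c`. [cite: Flicker1998UnitaryFL, p. 84 REMARK] -/
theorem conductor_mul_alpha_mem_order (hα : ρ α ≠ α) (hα1 : Valued.v α ≤ 1) (hint : ∀ z : K, Valued.v z ≤ 1 → Valued.v ((z - ρ z) / (α - ρ α)) ≤ 1)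
    {c : K} (hc : ρ c = c) (hc1 : Valued.v c ≤ 1) :
    Valued.v (c * α) ≤ 1 ∧ Valued.v (c * α - ρ (c * α)) ≤ Valued.v (c * (α - ρ α)) :=
  conductor_mul_mem_order hα hint hc hc1 hα1

/-- The order is closed under ADDITION. [cite: Flicker1998UnitaryFL, p. 84 REMARK] -/
theorem add_mem_order {c x y : K} (hx : Valued.v x ≤ 1 ∧ Valued.v (x - ρ x) ≤ Valued.v (c * (α - ρ α)))
    (hy : Valued.v y ≤ 1 ∧ Valued.v (y - ρ y) ≤ Valued.v (c * (α - ρ α))) :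
    Valued.v (x + y) ≤ 1 ∧ Valued.v (x + y - ρ (x + y)) ≤ Valued.v (c * (α - ρ α)) := by
  refine ⟨(Valuation.map_add _ _ _).trans (max_le hx.1 hy.1), ?_⟩
  rw [map_add, show x + y - (ρ x + ρ y) = (x - ρ x) + (y - ρ y) by ring]
  exact (Valuation.map_add _ _ _).trans (max_le hx.2 hy.2)

/-- The order is closed under NEGATION. [cite: Flicker1998UnitaryFL, p. 84 REMARK] -/
theorem neg_mem_order {c x : K} (hx : Valued.v x ≤ 1 ∧ Valued.v (x - ρ x) ≤ Valued.v (c * (α - ρ α))) :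
    Valued.v (-x) ≤ 1 ∧ Valued.v (-x - ρ (-x)) ≤ Valued.v (c * (α - ρ α)) := by
  refine ⟨by rw [Valuation.map_neg]; exact hx.1, ?_⟩
  rw [map_neg, show -x - -ρ x = -(x - ρ x) by ring, Valuation.map_neg]
  exact hx.2

/-- The order is closed under SUBTRACTION. [cite: Flicker1998UnitaryFL, p. 84 REMARK] -/
theorem sub_mem_order {c x y : K} (hx : Valued.v x ≤ 1 ∧ Valued.v (x - ρ x) ≤ Valued.v (c * (α - ρ α)))
    (hy : Valued.v y ≤ 1 ∧ Valued.v (y - ρ y) ≤ Valued.v (c * (α - ρ α))) :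
    Valued.v (x - y) ≤ 1 ∧ Valued.v (x - y - ρ (x - y)) ≤ Valued.v (c * (α - ρ α)) := by
  have h := add_mem_order hx (neg_mem_order hy)
  rwa [← sub_eq_add_neg] at h

/-- The order is closed under MULTIPLICATION (`xy − ρ(xy) = (x − ρx)y + ρx(y − ρy)`; `ρ` isometric). [cite: Flicker1998UnitaryFL, p. 84 REMARK] -/
theorem mul_mem_order (hvρ : ∀ x, Valued.v (ρ x) = Valued.v x) {c x y : K}
    (hx : Valued.v x ≤ 1 ∧ Valued.v (x - ρ x) ≤ Valued.v (c * (α - ρ α)))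
    (hy : Valued.v y ≤ 1 ∧ Valued.v (y - ρ y) ≤ Valued.v (c * (α - ρ α))) :
    Valued.v (x * y) ≤ 1 ∧ Valued.v (x * y - ρ (x * y)) ≤ Valued.v (c * (α - ρ α)) := by
  refine ⟨by rw [map_mul]; exact mul_le_one' hx.1 hy.1, ?_⟩
  rw [map_mul ρ, show x * y - ρ x * ρ y = (x - ρ x) * y + ρ x * (y - ρ y) by ring]
  refine (Valuation.map_add _ _ _).trans (max_le ?_ ?_)
  · rw [map_mul]; exact mul_le_of_le_of_le_one hx.2 hy.1
  · rw [map_mul, hvρ]; exact mul_le_of_le_one_of_le hx.1 hy.2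

/-- The order is `ρ`-STABLE. [cite: Flicker1998UnitaryFL, p. 84 REMARK] -/
theorem map_mem_order (hρρ : ∀ x, ρ (ρ x) = x) (hvρ : ∀ x, Valued.v (ρ x) = Valued.v x) {c x : K}
    (hx : Valued.v x ≤ 1 ∧ Valued.v (x - ρ x) ≤ Valued.v (c * (α - ρ α))) :
    Valued.v (ρ x) ≤ 1 ∧ Valued.v (ρ x - ρ (ρ x)) ≤ Valued.v (c * (α - ρ α)) := by
  refine ⟨by rw [hvρ]; exact hx.1, ?_⟩
  rw [hρρ, Valuation.map_sub_swap]; exact hx.2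

/-- MONOTONICITY: the order of conductor `c` is contained in the order of conductor `c′` whenever `|c| ≤ |c′|`. [cite: Flicker1998UnitaryFL, p. 84 REMARK] -/
theorem mem_order_mono {c c' x : K} (hcc : Valued.v c ≤ Valued.v c')
    (hx : Valued.v x ≤ 1 ∧ Valued.v (x - ρ x) ≤ Valued.v (c * (α - ρ α))) :
    Valued.v x ≤ 1 ∧ Valued.v (x - ρ x) ≤ Valued.v (c' * (α - ρ α)) :=
  ⟨hx.1, hx.2.trans (by rw [map_mul, map_mul]; exact mul_le_mul' hcc le_rfl)⟩

/-- UNIT CONDUCTOR: for `|c| = 1` the order is all of `𝒪`. [cite: Serre1979, Ch. III §6 Prop. 12] -/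
theorem mem_order_iff_of_v_eq_one (hα : ρ α ≠ α) (hint : ∀ z : K, Valued.v z ≤ 1 → Valued.v ((z - ρ z) / (α - ρ α)) ≤ 1)
    {c : K} (hc1 : Valued.v c = 1) (x : K) :
    (Valued.v x ≤ 1 ∧ Valued.v (x - ρ x) ≤ Valued.v (c * (α - ρ α))) ↔ Valued.v x ≤ 1 := by
  refine ⟨fun h => h.1, fun h => ⟨h, ?_⟩⟩
  rw [map_mul, hc1, one_mul]
  exact v_sub_map_le_of_v_le_one hα hint h

/-- MEMBERSHIP BY COORDINATES: `x` lies in the order of conductor `c` iff `|x| ≤ 1 ∧ |b(x)| ≤ |c|`. [cite: Serre1979, Ch. III §6 Prop. 12] -/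
theorem mem_order_iff_v_bCoord_le (hα : ρ α ≠ α) (c x : K) :
    (Valued.v x ≤ 1 ∧ Valued.v (x - ρ x) ≤ Valued.v (c * (α - ρ α))) ↔ (Valued.v x ≤ 1 ∧ Valued.v ((x - ρ x) / (α - ρ α)) ≤ Valued.v c) := by
  rw [v_sub_map_le_iff hα]

/-- **THE ORDER OF CONDUCTOR `c` IS `𝒪^ρ + c·𝒪`**: `|z| ≤ 1 ∧ |z − ρz| ≤ |c(α − ρα)|` iff `z = a + c·y` with `a` a fixed integer and `y` an integer
(`→`: `y := (b(z)∕c)·α`, `a := a(z)`). [cite: Flicker1998UnitaryFL, p. 84 REMARK] [cite: Serre1979, Ch. III §6 Prop. 12] -/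
theorem mem_order_iff_exists (hρρ : ∀ x, ρ (ρ x) = x) (hα : ρ α ≠ α) (hα1 : Valued.v α ≤ 1)
    (hint : ∀ z : K, Valued.v z ≤ 1 → Valued.v ((z - ρ z) / (α - ρ α)) ≤ 1)
    {c : K} (hc : ρ c = c) (hc0 : c ≠ 0) (hc1 : Valued.v c ≤ 1) (z : K) :
    (Valued.v z ≤ 1 ∧ Valued.v (z - ρ z) ≤ Valued.v (c * (α - ρ α))) ↔
      ∃ a y : K, ρ a = a ∧ Valued.v a ≤ 1 ∧ Valued.v y ≤ 1 ∧ z = a + c * y := by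
  constructor
  · rintro ⟨hz, hzc⟩
    have hb : Valued.v ((z - ρ z) / (α - ρ α)) ≤ Valued.v c := (v_sub_map_le_iff hα c z).1 hzc
    have hvc0 : Valued.v c ≠ 0 := (Valuation.ne_zero_iff _).2 hc0
    refine ⟨z - (z - ρ z) / (α - ρ α) * α, (z - ρ z) / (α - ρ α) / c * α, map_aCoord hρρ hα z, v_aCoord_le_one hα1 hint hz, ?_, ?_⟩
    · rw [map_mul, map_div₀]
      exact mul_le_one' (div_le_one_of_le₀ hb zero_le) hα1
    · have h1 : c * ((z - ρ z) / (α - ρ α) / c * α) = (z - ρ z) / (α - ρ α) * α := by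
        field_simp
      rw [h1, sub_add_cancel]
  · rintro ⟨a, y, ha, ha1, hy, rfl⟩
    exact add_mem_order (mem_order_of_fixed c ha ha1) (conductor_mul_mem_order hα hint hc hc1 hy)

/-- The FIXED elements of the order of conductor `c` are exactly the fixed integers (no condition from `c`). [cite: Flicker1998UnitaryFL, p. 84 REMARK] -/
theorem mem_order_iff_of_fixed (c : K) {a : K} (ha : ρ a = a) :
    (Valued.v a ≤ 1 ∧ Valued.v (a - ρ a) ≤ Valued.v (c * (α - ρ α))) ↔ Valued.v a ≤ 1 :=
  ⟨fun h => h.1, fun h => mem_order_of_fixed c ha h⟩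

/-- `α` itself lies in the order of conductor `c` iff `|c| = 1` (given `|c| ≤ 1`, `|α| ≤ 1`): the orders of conductor `|c| < 1` are PROPER. [cite: Serre1979, Ch. III §6 Prop. 12] -/
theorem alpha_mem_order_iff (hα : ρ α ≠ α) (hα1 : Valued.v α ≤ 1) {c : K} (hc1 : Valued.v c ≤ 1) :
    (Valued.v α ≤ 1 ∧ Valued.v (α - ρ α) ≤ Valued.v (c * (α - ρ α))) ↔ Valued.v c = 1 := by
  have hd : Valued.v (α - ρ α) ≠ 0 := (Valuation.ne_zero_iff _).2 (sub_ne_zero.2 (Ne.symm hα))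
  rw [map_mul]
  constructor
  · rintro ⟨-, h⟩
    have h1 : 1 ≤ Valued.v c := le_of_mul_le_mul_right (by rwa [one_mul]) (zero_lt_iff.2 hd)
    exact le_antisymm hc1 h1
  · intro h; exact ⟨hα1, by rw [h, one_mul]⟩

end Orders
/-! ## §3 Multipliers: `λ·Λ ⊆ Λ ⟺ λ` lies in the order -/

section Multipliers

variable {K : Type*} [Field K] [Valued K ℤᵐ⁰] {ρ : K →+* K} {α : K}

/-- **MULTIPLIER CRITERION FOR AN ORDER**: `λ·(order of conductor c) ⊆ (order of conductor c) ⟺ λ` lies in it (`1` lies in the order; the order is a ring).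
[cite: Flicker1998UnitaryFL, p. 84 REMARK] -/
theorem forall_mul_mem_order_iff (hvρ : ∀ x, Valued.v (ρ x) = Valued.v x) (c l : K) :
    (∀ x, (Valued.v x ≤ 1 ∧ Valued.v (x - ρ x) ≤ Valued.v (c * (α - ρ α))) →
        (Valued.v (l * x) ≤ 1 ∧ Valued.v (l * x - ρ (l * x)) ≤ Valued.v (c * (α - ρ α)))) ↔
      (Valued.v l ≤ 1 ∧ Valued.v (l - ρ l) ≤ Valued.v (c * (α - ρ α))) := by
  refine ⟨fun h => by simpa using h 1 (one_mem_order c), fun hl x hx => mul_mem_order hvρ hl hx⟩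

/-- The multiplier condition in coordinates: `λ` lies in the order of conductor `c` iff `|λ| ≤ 1 ∧ |b(λ)| ≤ |c|` — for a non-fixed integer `λ` the admissible conductors
are exactly the fixed `c` with `|b(λ)| ≤ |c| ≤ 1` (the finitely many orders `𝒪_0 ⊋ 𝒪_1 ⊋ ⋯ ⊋ 𝒪_{j_λ}` containing `λ`). [cite: Flicker1998UnitaryFL, p. 84 REMARK] -/
theorem multiplier_iff_v_bCoord_le (hα : ρ α ≠ α) (c l : K) :
    (Valued.v l ≤ 1 ∧ Valued.v (l - ρ l) ≤ Valued.v (c * (α - ρ α))) ↔ (Valued.v l ≤ 1 ∧ Valued.v ((l - ρ l) / (α - ρ α)) ≤ Valued.v c) :=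
  mem_order_iff_v_bCoord_le hα c l

end Multipliers

/-! ## §4 Trace duals (Euler): `(𝒪^ρ + c𝒪)^* = (c(α − ρα))⁻¹·(𝒪^ρ + c𝒪)` -/

section Duals

variable {K : Type*} [Field K] [Valued K ℤᵐ⁰] {ρ : K →+* K} {α : K}

/-- **DUAL, `⊇`**: if `u` lies in the order of conductor `c` then `y = u∕(c(α − ρα))` pairs integrally with the whole order: `|Tr(x·y)| ≤ 1` for every `x` in the order
(`Tr(xy) = b(xu)∕c` and `xu` lies in the order). [cite: Serre1979, Ch. III §6 Prop. 11] -/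
theorem v_trace_mul_le_one_of_mem_order (hρρ : ∀ x, ρ (ρ x) = x) (hvρ : ∀ x, Valued.v (ρ x) = Valued.v x) (hα : ρ α ≠ α)
    {c : K} (hc : ρ c = c) (hc0 : c ≠ 0) {u x : K}
    (hu : Valued.v u ≤ 1 ∧ Valued.v (u - ρ u) ≤ Valued.v (c * (α - ρ α)))
    (hx : Valued.v x ≤ 1 ∧ Valued.v (x - ρ x) ≤ Valued.v (c * (α - ρ α))) :
    Valued.v (x * (u / (c * (α - ρ α))) + ρ (x * (u / (c * (α - ρ α))))) ≤ 1 := by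
  have hvc0 : Valued.v c ≠ 0 := (Valuation.ne_zero_iff _).2 hc0
  have hxu := mul_mem_order hvρ hx hu
  have hb : Valued.v ((x * u - ρ (x * u)) / (α - ρ α)) ≤ Valued.v c := (v_sub_map_le_iff hα c _).1 hxu.2
  rw [trace_mul_div_eq hρρ hα hc hc0, map_div₀]
  exact div_le_one_of_le₀ hb zero_le

/-- **DUAL, `⊆`**: if `|Tr(x·y)| ≤ 1` for every `x` in the order of conductor `c`, then `u := c(α − ρα)·y` lies in that order (test `x = 1`: `|b(u)| ≤ |c|`; test `x = cα`:
`b(αu) = a(u) + b(u)(α + ρα)` is an integer, hence so is `a(u)`, hence `|u| ≤ 1`). [cite: Serre1979, Ch. III §6 Prop. 11] -/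
theorem mem_order_of_forall_v_trace_mul_le_one (hρρ : ∀ x, ρ (ρ x) = x) (hvρ : ∀ x, Valued.v (ρ x) = Valued.v x) (hα : ρ α ≠ α) (hα1 : Valued.v α ≤ 1)
    (hint : ∀ z : K, Valued.v z ≤ 1 → Valued.v ((z - ρ z) / (α - ρ α)) ≤ 1)
    {c : K} (hc : ρ c = c) (hc0 : c ≠ 0) (hc1 : Valued.v c ≤ 1) {y : K}
    (h : ∀ x, (Valued.v x ≤ 1 ∧ Valued.v (x - ρ x) ≤ Valued.v (c * (α - ρ α))) → Valued.v (x * y + ρ (x * y)) ≤ 1) :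
    Valued.v (c * (α - ρ α) * y) ≤ 1 ∧ Valued.v (c * (α - ρ α) * y - ρ (c * (α - ρ α) * y)) ≤ Valued.v (c * (α - ρ α)) := by
  have hd : α - ρ α ≠ 0 := sub_ne_zero.2 (Ne.symm hα)
  have hcd : c * (α - ρ α) ≠ 0 := mul_ne_zero hc0 hd
  have hvc0 : Valued.v c ≠ 0 := (Valuation.ne_zero_iff _).2 hc0
  set u : K := c * (α - ρ α) * y with hu
  have hy : y = u / (c * (α - ρ α)) := by rw [hu, mul_comm, mul_div_cancel_right₀ _ hcd]
  -- the coordinates of `u`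
  set bu : K := (u - ρ u) / (α - ρ α) with hbu
  set au : K := u - bu * α with hau
  have hbufix : ρ bu = bu := map_bCoord hρρ α u
  have haufix : ρ au = au := map_aCoord hρρ hα u
  have hudec : u = au + bu * α := (sub_add_cancel u _).symm
  -- test `x = 1`: `|b(u)| ≤ |c|`
  have hb : Valued.v bu ≤ Valued.v c := by
    have h1 := h 1 (one_mem_order c)
    rw [hy, trace_mul_div_eq hρρ hα hc hc0, one_mul, map_div₀] at h1
    rwa [div_le_one₀ (zero_lt_iff.2 hvc0)] at h1
  have hb1 : Valued.v bu ≤ 1 := hb.trans hc1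
  -- test `x = cα`: `b(αu) = a(u) + b(u)(α + ρα)` is an integer
  have hs1 : Valued.v (α + ρ α) ≤ 1 := (Valuation.map_add _ _ _).trans (max_le hα1 (by rw [hvρ]; exact hα1))
  have ha : Valued.v au ≤ 1 := by
    have h2 := h (c * α) (conductor_mul_alpha_mem_order hα hα1 hint hc hc1)
    rw [hy, trace_mul_div_eq hρρ hα hc hc0, mul_assoc, bCoord_fixed_mul α hc, mul_div_cancel_left₀ _ hc0] at h2
    rw [hudec, bCoord_alpha_mul hα haufix hbufix] at h2
    have h3 : Valued.v (bu * (α + ρ α)) ≤ 1 := by rw [map_mul]; exact mul_le_one' hb1 hs1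
    have h4 := Valuation.map_sub Valued.v (au + bu * (α + ρ α)) (bu * (α + ρ α))
    rw [add_sub_cancel_right] at h4
    exact h4.trans (max_le h2 h3)
  refine ⟨?_, (v_sub_map_le_iff hα c u).2 hb⟩
  rw [hudec]
  refine (Valuation.map_add _ _ _).trans (max_le ha ?_)
  rw [map_mul]; exact mul_le_one' hb1 hα1

/-- **THE TRACE DUAL OF AN ORDER (Euler)**: `y` pairs integrally under `Tr(x·y) = xy + ρ(xy)` with the whole order of conductor `c` iff `c(α − ρα)·y` lies in that order —
`(𝒪^ρ + c·𝒪)^* = (c(α − ρα))⁻¹·(𝒪^ρ + c·𝒪)`, the codifferent of the power basis `1, cα` (`f′(cα) = c(α − ρα)`). [cite: Serre1979, Ch. III §6 Prop. 11] -/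
theorem forall_v_trace_mul_le_one_iff (hρρ : ∀ x, ρ (ρ x) = x) (hvρ : ∀ x, Valued.v (ρ x) = Valued.v x) (hα : ρ α ≠ α) (hα1 : Valued.v α ≤ 1)
    (hint : ∀ z : K, Valued.v z ≤ 1 → Valued.v ((z - ρ z) / (α - ρ α)) ≤ 1)
    {c : K} (hc : ρ c = c) (hc0 : c ≠ 0) (hc1 : Valued.v c ≤ 1) (y : K) :
    (∀ x, (Valued.v x ≤ 1 ∧ Valued.v (x - ρ x) ≤ Valued.v (c * (α - ρ α))) → Valued.v (x * y + ρ (x * y)) ≤ 1) ↔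
      (Valued.v (c * (α - ρ α) * y) ≤ 1 ∧ Valued.v (c * (α - ρ α) * y - ρ (c * (α - ρ α) * y)) ≤ Valued.v (c * (α - ρ α))) := by
  refine ⟨mem_order_of_forall_v_trace_mul_le_one hρρ hvρ hα hα1 hint hc hc0 hc1, fun hu x hx => ?_⟩
  have hcd : c * (α - ρ α) ≠ 0 := mul_ne_zero hc0 (sub_ne_zero.2 (Ne.symm hα))
  have hy : y = (c * (α - ρ α) * y) / (c * (α - ρ α)) := by rw [mul_comm, mul_div_cancel_right₀ _ hcd]
  rw [hy]
  exact v_trace_mul_le_one_of_mem_order hρρ hvρ hα hc hc0 hu hx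

end Duals

end Literature.NumberTheory.LocalFields.QuadraticOrder
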